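import Literature.NumberTheory.ModularForms.EisensteinLatticeCoset
import Literature.NumberTheory.EllipticCurves.EisensteinSeriesNebentypusLattice
import Mathlib.NumberTheory.ModularForms.QExpansion
import HarnessLib

/-!
# The `q_N`-expansion of the Eisenstein series `G_k^a` over a congruence class

Topic `Literature/NumberTheory/ModularForms`; namespace `Literature.NumberTheory.ModularForms`.
Sequel of `EisensteinLatticeCoset` (the modular form `latticeEisensteinMF N hk a ∈ M_k(Γ(N))`,
`G_k^a(τ) = ∑_{x ∈ ℤ², x ≡ a (N)} (x₀τ + x₁)^{-k}`, `k ≥ 3`).  Here its Fourier expansion at `∞` in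
the variable `q_N = e^{2πiτ/N}` is computed exactly as in Diamond–Shurman, *A First Course in
Modular Forms*, §4.2, proof of Thm. 4.2.3 (rows, Lipschitz's formula (4.5)/(1.2), regrouping):
for `a = (a₀, a₁) ∈ (ℤ/Nℤ)²` with representatives `0 ≤ c₀, d₀ < N`,

  `G_k^a(τ) = [a₀ = 0] Z_k(a₁)
     + (C_k / N^k) ∑_{n ≥ 1} ( ∑_{cm = n, c ≥ 1} ([c ≡ c₀] e^{2πi d₀ m/N}
                                   + (-1)^k [c ≡ -c₀] e^{-2πi d₀ m/N}) m^{k-1} ) q_Nⁿ`,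

`C_k = (-2πi)^k/(k-1)!`, `Z_k(d) = ∑_{j ∈ ℤ} (jN + d̃)^{-k}` (`d̃` the representative of `d`; the
term `jN + d̃ = 0` is `0`), cf. op. cit. (4.5)–(4.6) and Thm. 4.2.3.

* `cosetZeta N k d = Z_k(d)`, `latticeEisensteinWeight`, `latticeEisensteinCoeff N k a n` — the
  coefficients above (definitions);
* `latticeEisenstein_eq_tsum_prod`, `tsum_cosetSummand_row`, `tsum_row_pos`, `tsum_row_neg` — the
  sum over the class as a double sum, its rows, Lipschitz for the rows `c > 0`, the rows `c < 0`;
* `tsum_prod_weight_mul_pow_eq` — `∑_{c,m ≥ 1} W(c,m) m^k r^{cm} = ∑_n (∑_{cm=n} W(c,m)m^k) rⁿ`;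
* **`hasSum_latticeEisenstein`** — the expansion as a `HasSum` in `q_N` at every `τ ∈ ℍ`;
* **`qExpansion_coeff_latticeEisensteinMF`** — `coeff n (qExpansion N (G_k^a)) =
  latticeEisensteinCoeff N k a n` (Mathlib's `qExpansion` of period `N`, by uniqueness
  `ModularFormClass.qExpansion_coeff_unique`, `N ∈ strictPeriods Γ(N)`).

Everything is proved; the three definitions are the coefficient bookkeeping only (no named fact).
These expansions are the input of the `q`-expansion principle for `SL₂(ℤ)`-translates of forms on
`Γ₁(N)` (discharge of `Sturm1987_congruence_modPrime_gamma1`, `SturmCongruenceProofs`).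

## References

* [DiamondShurman2005] F. Diamond, J. Shurman, *A First Course in Modular Forms*, GTM 228
  (2005), §4.2, (4.5)–(4.6), Thm. 4.2.3; §1.1 (1.2) (Lipschitz).
-/

noncomputable section

namespace Literature.NumberTheory.ModularForms

open scoped MatrixGroups Real CongruenceSubgroup
open UpperHalfPlane hiding I
open EisensteinSeries Complex Filter Function PowerSeries
open Literature.NumberTheory.EllipticCurves.ModularForms (tsum_zpow_neg_eq_tsum_cexp
  tsum_int_eq_sum_zmod_tsum intCast_mul_add_val summable_pow_mul_cexp_pow)

/-! ### The coefficients -/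

section Defs

variable (N : ℕ) (k : ℕ)

/-- The constant row `Z_k(d) = ∑_{j ∈ ℤ} (jN + d̃)^{-k}`, `d̃ ∈ {0, …, N-1}` the representative of
`d mod N` (the term with `jN + d̃ = 0`, present iff `d = 0`, is `0^{-k} = 0`): the constant term of
`G_k^{(0,d)}` at `∞` (Diamond–Shurman (4.5)–(4.6), there written via `ζ^d(k)`).
[cite: DiamondShurman2005, §4.2 (4.6)] -/
def cosetZeta (d : ZMod N) : ℂ := ∑' j : ℤ, ((j : ℂ) * N + (d.val : ℂ)) ^ (-(k : ℤ))

/-- The root-of-unity weight `w_a(c, m) = [c ≡ a₀] e^{2πi ã₁ m/N} + (-1)^k [c ≡ -a₀] e^{-2πi ã₁ m/N}`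
of the pair `(c, m)` (`c, m ≥ 1`, `cm = n`) in the `n`-th coefficient of `G_k^a`.
[cite: DiamondShurman2005, §4.2 proof of Thm. 4.2.3] -/
def latticeEisensteinWeight (a : Fin 2 → ZMod N) (c m : ℕ) : ℂ :=
  (if ((c : ZMod N)) = a 0 then cexp (2 * π * Complex.I * ((a 1).val * m) / N) else 0) +
    (-1) ^ k * (if ((c : ZMod N)) = -a 0 then cexp (-(2 * π * Complex.I * ((a 1).val * m) / N)) else 0)

/-- **The `q_N`-expansion coefficients of `G_k^a`**: `b₀ = [a₀ = 0] Z_k(a₁)` and, for `n ≥ 1`,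
`bₙ = (C_k/N^k) ∑_{cm = n} w_a(c, m) m^{k-1}`, `C_k = (-2πi)^k/(k-1)!`.
[cite: DiamondShurman2005, Thm. 4.2.3] -/
def latticeEisensteinCoeff (a : Fin 2 → ZMod N) (n : ℕ) : ℂ :=
  if n = 0 then (if a 0 = 0 then cosetZeta N k (a 1) else 0)
  else ((N : ℂ) ^ k)⁻¹ * ((-2 * π * Complex.I) ^ k / (k - 1).factorial) *
    ∑ p ∈ n.divisorsAntidiagonal, latticeEisensteinWeight N k a p.1 p.2 * (p.2 : ℂ) ^ (k - 1)

variable {N k}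

/-- `|w_a(c, m)| ≤ 2`. [folklore] -/
theorem norm_latticeEisensteinWeight_le (a : Fin 2 → ZMod N) (c m : ℕ) :
    ‖latticeEisensteinWeight N k a c m‖ ≤ 2 := by
  unfold latticeEisensteinWeight
  refine (norm_add_le _ _).trans ?_
  have h1 : ‖(if ((c : ZMod N)) = a 0 then cexp (2 * π * Complex.I * ((a 1).val * m) / N) else 0)‖ ≤ 1 := by
    split_ifs
    · rw [show (2 * π * Complex.I * ((a 1).val * m) / N : ℂ) = ↑(2 * π * ((a 1).val * m) / N : ℝ) * Complex.I by
        push_cast; ring, Complex.norm_exp_ofReal_mul_I]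
    · simp
  have h2 : ‖(-1 : ℂ) ^ k * (if ((c : ZMod N)) = -a 0 then
      cexp (-(2 * π * Complex.I * ((a 1).val * m) / N)) else 0)‖ ≤ 1 := by
    rw [norm_mul, norm_pow, norm_neg, norm_one, one_pow, one_mul]
    split_ifs
    · rw [show (-(2 * π * Complex.I * ((a 1).val * m) / N) : ℂ) = ↑(-(2 * π * ((a 1).val * m) / N) : ℝ) * Complex.I
        by push_cast; ring, Complex.norm_exp_ofReal_mul_I]
    · simp
  linarith

end Defs

/-! ### Resummation `∑_{c,m ≥ 1} W(c,m) m^k r^{cm} = ∑_n (∑_{cm = n} W(c,m) m^k) rⁿ` -/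

section Resummation

variable (k : ℕ) {r : ℂ} (W : ℕ → ℕ → ℂ) {B : ℝ}

/-- The double family `(c, m) ↦ W(c,m) m^k r^{cm}` on `ℕ₊²` is summable for `‖r‖ < 1` and a bounded
weight `W` (comparison with Mathlib `summable_prod_mul_pow`). [folklore] -/
theorem summable_prod_weight_mul_pow' (hr : ‖r‖ < 1) (hW : ∀ c m, ‖W c m‖ ≤ B) :
    Summable fun p : ℕ+ × ℕ+ ↦ W p.1 p.2 * (p.2 : ℂ) ^ k * r ^ (p.1 * p.2 : ℕ) := by
  refine Summable.of_norm_bounded ((summable_prod_mul_pow k hr).norm.mul_left B) fun p ↦ ?_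
  rw [mul_assoc, norm_mul]
  exact mul_le_mul_of_nonneg_right (hW _ _) (norm_nonneg _)

/-- The fibre of the resummation over `n`: `∑_{(c,m) : cm = n} W(c,m) m^k r^{cm} =
(∑_{cm = n} W(c,m) m^k) rⁿ`. [folklore] -/
theorem sum_fiber_weight_mul_pow (n : ℕ+) :
    ∑ x : {x // x ∈ (n : ℕ).divisorsAntidiagonal},
        (fun p : ℕ+ × ℕ+ ↦ W p.1 p.2 * (p.2 : ℂ) ^ k * r ^ (p.1 * p.2 : ℕ))
          (sigmaAntidiagonalEquivProd ⟨n, x⟩) =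
      (∑ p ∈ (n : ℕ).divisorsAntidiagonal, W p.1 p.2 * (p.2 : ℂ) ^ k) * r ^ (n : ℕ) := by
  simp only [sigmaAntidiagonalEquivProd, divisorsAntidiagonalFactors, Equiv.coe_fn_mk, PNat.mk_coe]
  rw [Finset.sum_mul, Finset.univ_eq_attach,
    (n : ℕ).divisorsAntidiagonal.sum_attach fun x : ℕ × ℕ ↦ W x.1 x.2 * (x.2 : ℂ) ^ k * r ^ (x.1 * x.2)]
  refine Finset.sum_congr rfl fun p hp ↦ ?_
  rw [(Nat.mem_divisorsAntidiagonal.mp hp).1]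

/-- **Resummation**: `∑_{(c,m) ∈ ℕ₊²} W(c,m) m^k r^{cm} = ∑_{n ≥ 1} (∑_{cm = n} W(c,m) m^k) rⁿ` for
`‖r‖ < 1` and bounded `W` (absolute convergence and the bijection `(c, m) ↦ n = cm`, Mathlib
`sigmaAntidiagonalEquivProd`). [folklore] -/
theorem tsum_prod_weight_mul_pow_eq (hr : ‖r‖ < 1) (hW : ∀ c m, ‖W c m‖ ≤ B) :
    ∑' p : ℕ+ × ℕ+, W p.1 p.2 * (p.2 : ℂ) ^ k * r ^ (p.1 * p.2 : ℕ) =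
      ∑' n : ℕ+, (∑ p ∈ (n : ℕ).divisorsAntidiagonal, W p.1 p.2 * (p.2 : ℂ) ^ k) * r ^ (n : ℕ) := by
  have hs' := sigmaAntidiagonalEquivProd.summable_iff.mpr (summable_prod_weight_mul_pow' k W hr hW)
  simp only [Function.comp_def] at hs'
  rw [← sigmaAntidiagonalEquivProd.tsum_eq, hs'.tsum_sigma]
  refine tsum_congr fun n ↦ ?_
  rw [tsum_fintype]
  exact sum_fiber_weight_mul_pow k W n

/-- Summability of the resummed series `n ↦ (∑_{cm = n} W(c,m) m^k) rⁿ`. [folklore] -/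
theorem summable_divisorSum_weight_mul_pow (hr : ‖r‖ < 1) (hW : ∀ c m, ‖W c m‖ ≤ B) :
    Summable fun n : ℕ+ ↦
      (∑ p ∈ (n : ℕ).divisorsAntidiagonal, W p.1 p.2 * (p.2 : ℂ) ^ k) * r ^ (n : ℕ) := by
  have hs' := sigmaAntidiagonalEquivProd.summable_iff.mpr (summable_prod_weight_mul_pow' k W hr hW)
  simp only [Function.comp_def] at hs'
  refine hs'.sigma.congr fun n ↦ ?_
  rw [tsum_fintype]
  exact sum_fiber_weight_mul_pow k W n

end Resummation

/-! ### The class sum as a double sum over `ℤ × ℤ`, and its rows -/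

section Rows

variable (N : ℕ) (k : ℕ) (a : Fin 2 → ZMod N) (z : ℍ)

/-- The summand of `G_k^a` extended by `0` to `ℤ²`: `[x ≡ a (N)] (x₀ z + x₁)^{-k}`. [folklore] -/
def cosetSummand (p : ℤ × ℤ) : ℂ :=
  if ((p.1 : ZMod N) = a 0 ∧ (p.2 : ZMod N) = a 1) then ((p.1 : ℂ) * z + p.2) ^ (-(k : ℤ)) else 0

/-- `G_k^a(z) = ∑_{(c,d) ∈ ℤ²} [c ≡ a₀, d ≡ a₁] (cz + d)^{-k}`. [folklore] -/
theorem latticeEisenstein_eq_tsum_prod :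
    latticeEisenstein N k a z = ∑' p : ℤ × ℤ, cosetSummand N k a z p := by
  unfold latticeEisenstein
  rw [tsum_subtype (latticeCoset N a) (fun x ↦ eisSummand k x z),
    ← (finTwoArrowEquiv ℤ).symm.tsum_eq]
  refine tsum_congr fun p ↦ ?_
  have hiff : (![p.1, p.2] ∈ latticeCoset N a) ↔ ((p.1 : ZMod N) = a 0 ∧ (p.2 : ZMod N) = a 1) := by
    rw [mem_latticeCoset, funext_iff, Fin.forall_fin_two]
    simp
  simp only [finTwoArrowEquiv_symm_apply, cosetSummand]
  by_cases h : ((p.1 : ZMod N) = a 0 ∧ (p.2 : ZMod N) = a 1)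
  · rw [Set.indicator_of_mem (hiff.mpr h), if_pos h]
    simp [eisSummand]
  · rw [Set.indicator_of_notMem (fun h' ↦ h (hiff.mp h')), if_neg h]

/-- Absolute convergence of the extended summand on `ℤ²` (`k ≥ 3`; a sub-family of Mathlib's
`summable_norm_eisSummand`). [folklore] -/
theorem summable_cosetSummand (hk : 3 ≤ k) : Summable (cosetSummand N k a z) := by
  have hs : Summable fun p : ℤ × ℤ ↦ ‖eisSummand (k : ℤ) ((finTwoArrowEquiv ℤ).symm p) z‖ :=
    ((finTwoArrowEquiv ℤ).symm.summable_iff).mpr (summable_norm_eisSummand (by exact_mod_cast hk) z)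
  refine Summable.of_norm_bounded hs fun p ↦ ?_
  simp only [finTwoArrowEquiv_symm_apply, cosetSummand, eisSummand, Matrix.cons_val_zero,
    Matrix.cons_val_one, Matrix.cons_val_fin_one]
  split_ifs
  · exact le_rfl
  · simp

/-- **The rows**: for fixed `c ∈ ℤ`,
`∑_{d ∈ ℤ} [c ≡ a₀, d ≡ a₁] (cz + d)^{-k} = [c ≡ a₀] ∑_{j ∈ ℤ} (cz + jN + ã₁)^{-k}`
(summing the class `d ≡ a₁` as `d = jN + ã₁`). [cite: DiamondShurman2005, §4.2 proof of Thm. 4.2.3] -/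
theorem tsum_cosetSummand_row [NeZero N] (hk : 3 ≤ k) (c : ℤ) :
    ∑' d : ℤ, cosetSummand N k a z (c, d) =
      if (c : ZMod N) = a 0 then
        ∑' j : ℤ, ((c : ℂ) * z + ((j : ℂ) * N + ((a 1).val : ℂ))) ^ (-(k : ℤ)) else 0 := by
  by_cases hc : (c : ZMod N) = a 0
  · rw [if_pos hc]
    have hrow : Summable fun d : ℤ ↦ cosetSummand N k a z (c, d) :=
      (summable_cosetSummand N k a z hk).prod_factor c
    rw [tsum_int_eq_sum_zmod_tsum N hrow]
    simp only [cosetSummand, hc, true_and, intCast_mul_add_val]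
    rw [Finset.sum_eq_single (a 1) (fun x _ hx ↦ by simp [hx]) (fun h ↦ absurd (Finset.mem_univ _) h)]
    simp only [if_true]
    refine tsum_congr fun j ↦ ?_
    push_cast
    ring_nf
  · rw [if_neg hc]
    have : (fun d : ℤ ↦ cosetSummand N k a z (c, d)) = fun _ ↦ 0 := by
      funext d
      simp [cosetSummand, hc]
    rw [this, tsum_zero]

/-- **Lipschitz for the rows `c > 0`**: with `w = (cz + e)/N ∈ ℍ`,
`∑_{j ∈ ℤ} (cz + jN + e)^{-k} = N^{-k} ∑_j (w + j)^{-k} = (C_k/N^k) ∑_{m ≥ 0} m^{k-1} e^{2πi e m/N} q_N^{cm}`,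
`q_N = e^{2πiz/N}`, `C_k = (-2πi)^k/(k-1)!`. [cite: DiamondShurman2005, §4.2 (4.5) and §1.1 (1.2)] -/
theorem tsum_row_pos [NeZero N] (hk : 3 ≤ k) {c : ℕ} (hc : 0 < c) (e : ℤ) :
    ∑' j : ℤ, ((c : ℂ) * z + ((j : ℂ) * N + (e : ℂ))) ^ (-(k : ℤ)) =
      ((N : ℂ) ^ k)⁻¹ * ((-2 * π * Complex.I) ^ k / (k - 1).factorial) *
        ∑' m : ℕ, (m : ℂ) ^ (k - 1) *
          (cexp (2 * π * Complex.I * (e * m) / N) * Periodic.qParam (N : ℝ) z ^ (c * m)) := by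
  have hN : (N : ℂ) ≠ 0 := by exact_mod_cast NeZero.ne N
  have hNr : (0 : ℝ) < N := by exact_mod_cast NeZero.pos N
  have him : 0 < (((c : ℂ) * z + e) / N).im := by
    rw [Complex.div_natCast_im]
    simp only [Complex.add_im, Complex.mul_im, Complex.natCast_re, Complex.natCast_im, zero_mul,
      add_zero, Complex.intCast_im, UpperHalfPlane.coe_im, UpperHalfPlane.coe_re]
    exact div_pos (mul_pos (by exact_mod_cast hc) z.im_pos) hNr
  set w : ℍ := ⟨((c : ℂ) * z + e) / N, him⟩ with hw
  have hwc : (w : ℂ) = ((c : ℂ) * z + e) / N := rfl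
  have hterm : ∀ j : ℤ, ((c : ℂ) * z + ((j : ℂ) * N + (e : ℂ))) ^ (-(k : ℤ)) =
      ((N : ℂ) ^ k)⁻¹ * ((w : ℂ) + j) ^ (-(k : ℤ)) := by
    intro j
    have h : ((c : ℂ) * z + ((j : ℂ) * N + (e : ℂ))) = (N : ℂ) * ((w : ℂ) + j) := by
      rw [hwc]; field_simp; ring
    rw [h, mul_zpow, zpow_neg (N : ℂ), zpow_natCast]
  simp_rw [hterm]
  rw [tsum_mul_left, tsum_zpow_neg_eq_tsum_cexp (by omega) w, ← mul_assoc]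
  congr 1
  refine tsum_congr fun m ↦ ?_
  congr 1
  rw [Periodic.qParam, ← Complex.exp_nat_mul, ← Complex.exp_nat_mul, ← Complex.exp_add, hwc]
  congr 1
  push_cast
  field_simp
  ring

/-- **The rows `c < 0`**: `∑_{j} (-cz + jN + d)^{-k} = (-1)^k ∑_{j} (cz + jN - d)^{-k}` (substitute
`j ↦ -j`). [cite: DiamondShurman2005, §4.2 proof of Thm. 4.2.3] -/
theorem tsum_row_neg (c : ℤ) (d : ℂ) :
    ∑' j : ℤ, ((((-c : ℤ)) : ℂ) * z + ((j : ℂ) * N + d)) ^ (-(k : ℤ)) =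
      (-1) ^ k * ∑' j : ℤ, ((c : ℂ) * z + ((j : ℂ) * N + (-d))) ^ (-(k : ℤ)) := by
  rw [← (Equiv.neg ℤ).tsum_eq, ← tsum_mul_left]
  refine tsum_congr fun j ↦ ?_
  rw [Equiv.neg_apply]
  have h : ((((-c : ℤ)) : ℂ) * z + ((((-j : ℤ)) : ℂ) * N + d)) =
      (-1) * ((c : ℂ) * z + ((j : ℂ) * N + (-d))) := by
    push_cast; ring
  rw [h, mul_zpow]
  congr 1
  rw [zpow_neg, zpow_natCast, ← inv_pow, inv_neg_one]

end Rows

/-! ### The expansion -/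

section Expansion

variable (N : ℕ) [NeZero N] (k : ℕ) (a : Fin 2 → ZMod N) (z : ℍ)

/-- The two rows `±c` (`c ≥ 1`) together:
`[c ≡ a₀] R_c + [-c ≡ a₀] R_{-c} = (C_k/N^k) ∑_{m ≥ 0} w_a(c, m) m^{k-1} q_N^{cm}`.
[cite: DiamondShurman2005, §4.2 proof of Thm. 4.2.3] -/
theorem row_add_row_neg (hk : 3 ≤ k) (c : ℕ+) :
    (∑' d : ℤ, cosetSummand N k a z ((c : ℕ), d)) +
        ∑' d : ℤ, cosetSummand N k a z (-((c : ℕ) : ℤ), d) =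
      ((N : ℂ) ^ k)⁻¹ * ((-2 * π * Complex.I) ^ k / (k - 1).factorial) *
        ∑' m : ℕ, latticeEisensteinWeight N k a c m * (m : ℂ) ^ (k - 1) *
          Periodic.qParam (N : ℝ) z ^ ((c : ℕ) * m : ℕ) := by
  -- the two rows
  have hpos := tsum_cosetSummand_row N k a z hk ((c : ℕ) : ℤ)
  have hneg := tsum_cosetSummand_row N k a z hk (-((c : ℕ) : ℤ))
  rw [Int.cast_natCast] at hpos
  rw [hpos, hneg, tsum_row_neg N k z, Int.cast_natCast,
    show (((a 1).val : ℂ)) = (((a 1).val : ℤ) : ℂ) by push_cast; rfl,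
    show (-((((a 1).val : ℤ)) : ℂ)) = (((-((a 1).val : ℤ) : ℤ)) : ℂ) by push_cast; rfl,
    tsum_row_pos N k z hk c.pos, tsum_row_pos N k z hk c.pos]
  have hcond : ((((-((c : ℕ) : ℤ) : ℤ)) : ZMod N) = a 0) ↔ (((c : ℕ) : ZMod N) = -a 0) := by
    rw [Int.cast_neg, Int.cast_natCast, neg_eq_iff_eq_neg]
  -- summability of the inner series
  have hsum : ∀ e : ℤ, Summable fun m : ℕ ↦ (m : ℂ) ^ (k - 1) *
      (cexp (2 * π * Complex.I * (e * m) / N) * Periodic.qParam (N : ℝ) z ^ ((c : ℕ) * m)) := by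
    intro e
    have him : 0 < ((((c : ℕ) : ℂ) * z + e) / N).im := by
      rw [Complex.div_natCast_im]
      simp only [Complex.add_im, Complex.mul_im, Complex.natCast_re, Complex.natCast_im, zero_mul,
        add_zero, Complex.intCast_im, UpperHalfPlane.coe_im, UpperHalfPlane.coe_re]
      exact div_pos (mul_pos (by exact_mod_cast c.pos) z.im_pos) (by exact_mod_cast NeZero.pos N)
    refine (summable_pow_mul_cexp_pow (k - 1) ⟨_, him⟩).congr fun m ↦ ?_
    congr 1
    rw [Periodic.qParam, UpperHalfPlane.coe_mk, ← Complex.exp_nat_mul, ← Complex.exp_nat_mul,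
      ← Complex.exp_add]
    congr 1
    push_cast
    field_simp
    ring
  have hs1 := hsum ((a 1).val : ℤ)
  have hs2 := hsum (-((a 1).val : ℤ))
  have he1 : ∀ m : ℕ, cexp (2 * π * Complex.I * (((((a 1).val : ℤ)) : ℂ) * m) / N) =
      cexp (2 * π * Complex.I * (((a 1).val : ℂ) * m) / N) := fun m ↦ by push_cast; rfl
  have he2 : ∀ m : ℕ, cexp (2 * π * Complex.I * ((((-((a 1).val : ℤ) : ℤ)) : ℂ) * m) / N) =
      cexp (-(2 * π * Complex.I * (((a 1).val : ℂ) * m) / N)) := fun m ↦ by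
    congr 1
    push_cast
    ring
  simp only [he1, he2, hcond] at hs1 hs2 ⊢
  unfold latticeEisensteinWeight
  by_cases hP : ((c : ℕ) : ZMod N) = a 0 <;> by_cases hQ : ((c : ℕ) : ZMod N) = -a 0
  · simp only [if_pos hP, if_pos hQ]
    rw [mul_left_comm, ← mul_add]
    congr 1
    rw [← tsum_mul_left, ← hs1.tsum_add (hs2.mul_left _)]
    exact tsum_congr fun m ↦ by ring
  · simp only [if_pos hP, if_neg hQ, mul_zero, add_zero]
    congr 1
    exact tsum_congr fun m ↦ by ring
  · simp only [if_neg hP, if_pos hQ, zero_add]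
    rw [mul_left_comm]
    congr 1
    rw [← tsum_mul_left]
    exact tsum_congr fun m ↦ by ring
  · simp only [if_neg hP, if_neg hQ, zero_add, mul_zero, zero_mul, tsum_zero]

/-- **`G_k^a = b₀ + ∑_{n ≥ 1} bₙ q_Nⁿ`** with `bₙ = latticeEisensteinCoeff N k a n`
(Diamond–Shurman Thm. 4.2.3: rows `c = 0`, `c > 0`, `c < 0`, Lipschitz, regrouping by `n = cm`).
[cite: DiamondShurman2005, Thm. 4.2.3] -/
theorem latticeEisenstein_eq_coeff_zero_add_tsum (hk : 3 ≤ k) :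
    latticeEisenstein N k a z = latticeEisensteinCoeff N k a 0 +
      ∑' n : ℕ+, latticeEisensteinCoeff N k a n * Periodic.qParam (N : ℝ) z ^ (n : ℕ) := by
  have hS := summable_cosetSummand N k a z hk
  have hq : ‖Periodic.qParam (N : ℝ) z‖ < 1 := UpperHalfPlane.norm_qParam_lt_one N z
  have hW := norm_latticeEisensteinWeight_le (N := N) (k := k) a
  rw [latticeEisenstein_eq_tsum_prod, hS.tsum_prod, tsum_int_eq_zero_add_tsum_pnat hS.prod]
  -- the constant row
  have h0 : ∑' d : ℤ, cosetSummand N k a z (0, d) = latticeEisensteinCoeff N k a 0 := by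
    have := tsum_cosetSummand_row N k a z hk 0
    simp only [Int.cast_zero, zero_mul, zero_add] at this
    rw [this, latticeEisensteinCoeff, if_pos rfl]
    unfold cosetZeta
    by_cases h : a 0 = 0
    · rw [if_pos h, if_pos h.symm]
    · rw [if_neg h, if_neg (Ne.symm h)]
  -- the rows `±c`, `c ≥ 1`
  have h1 : Summable fun c : ℕ+ ↦ ∑' d : ℤ, cosetSummand N k a z ((c : ℕ), d) := by
    simpa [Function.comp_def] using
      hS.prod.comp_injective (i := fun c : ℕ+ ↦ ((c : ℕ) : ℤ)) (fun _ _ h ↦ by simpa using h)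
  have h2 : Summable fun c : ℕ+ ↦ ∑' d : ℤ, cosetSummand N k a z (-((c : ℕ) : ℤ), d) := by
    simpa [Function.comp_def] using
      hS.prod.comp_injective (i := fun c : ℕ+ ↦ -((c : ℕ) : ℤ)) (fun _ _ h ↦ by simpa using h)
  rw [h0, add_assoc, ← h1.tsum_add h2]
  simp_rw [row_add_row_neg N k a z hk]
  congr 1
  have hinner : ∀ c : ℕ+, ∑' m : ℕ, latticeEisensteinWeight N k a c m * (m : ℂ) ^ (k - 1) *
      Periodic.qParam (N : ℝ) z ^ ((c : ℕ) * m : ℕ) =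
      ∑' m : ℕ+, latticeEisensteinWeight N k a c m * ((m : ℕ) : ℂ) ^ (k - 1) *
        Periodic.qParam (N : ℝ) z ^ ((c : ℕ) * (m : ℕ) : ℕ) := fun c ↦
    (tsum_pnat_eq_tsum_of_eq_zero (f := fun m : ℕ ↦ latticeEisensteinWeight N k a c m *
      (m : ℂ) ^ (k - 1) * Periodic.qParam (N : ℝ) z ^ ((c : ℕ) * m : ℕ))
      (by simp [zero_pow (show k - 1 ≠ 0 by omega)])).symm
  simp_rw [hinner]
  rw [tsum_mul_left, ← (summable_prod_weight_mul_pow' (k - 1) (latticeEisensteinWeight N k a) hq hW).tsum_prod,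
    tsum_prod_weight_mul_pow_eq (k - 1) (latticeEisensteinWeight N k a) hq hW, ← tsum_mul_left]
  refine tsum_congr fun n ↦ ?_
  rw [latticeEisensteinCoeff, if_neg (PNat.ne_zero n)]
  ring

/-- **The `q_N`-expansion of `G_k^a` at every point**: `HasSum (bₙ q_Nⁿ)_{n ≥ 0} (G_k^a(z))`,
`q_N = e^{2πiz/N}`. [cite: DiamondShurman2005, Thm. 4.2.3] -/
theorem hasSum_latticeEisenstein (hk : 3 ≤ k) :
    HasSum (fun n : ℕ ↦ latticeEisensteinCoeff N k a n * Periodic.qParam (N : ℝ) z ^ n)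
      (latticeEisenstein N k a z) := by
  have hq : ‖Periodic.qParam (N : ℝ) z‖ < 1 := UpperHalfPlane.norm_qParam_lt_one N z
  have hW := norm_latticeEisensteinWeight_le (N := N) (k := k) a
  have hs : Summable fun n : ℕ+ ↦
      latticeEisensteinCoeff N k a n * Periodic.qParam (N : ℝ) z ^ (n : ℕ) := by
    refine ((summable_divisorSum_weight_mul_pow (k - 1) (latticeEisensteinWeight N k a) hq hW).mul_left
      (((N : ℂ) ^ k)⁻¹ * ((-2 * π * Complex.I) ^ k / (k - 1).factorial))).congr fun n ↦ ?_
    rw [latticeEisensteinCoeff, if_neg (PNat.ne_zero n)]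
    ring
  have h := hs.hasSum
  rw [hasSum_pnat_iff (f := fun n : ℕ ↦
    latticeEisensteinCoeff N k a n * Periodic.qParam (N : ℝ) z ^ n)] at h
  have hval : (∑' b : ℕ+, latticeEisensteinCoeff N k a b * Periodic.qParam (N : ℝ) z ^ (b : ℕ)) +
      latticeEisensteinCoeff N k a 0 * Periodic.qParam (N : ℝ) z ^ 0 = latticeEisenstein N k a z := by
    rw [pow_zero, mul_one, latticeEisenstein_eq_coeff_zero_add_tsum N k a z hk, add_comm]
  rw [hval] at h
  exact h

/-- **The `q_N`-expansion coefficients of the modular form `G_k^a ∈ M_k(Γ(N))`**: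
`coeff n (qExpansion N G_k^a) = bₙ` for Mathlib's `qExpansion` of period `N` (a strict period of
`Γ(N)`), by uniqueness of `q`-expansions. [cite: DiamondShurman2005, Thm. 4.2.3] -/
theorem qExpansion_coeff_latticeEisensteinMF (hk : 3 ≤ k) (n : ℕ) :
    (qExpansion (N : ℝ) (latticeEisensteinMF N (k := (k : ℤ)) (by exact_mod_cast hk) a)).coeff n =
      latticeEisensteinCoeff N k a n := by
  have hN0 : (0 : ℝ) < N := by exact_mod_cast NeZero.pos N
  have hper : ((N : ℕ) : ℝ) ∈ (CongruenceSubgroup.Gamma N : Subgroup (GL (Fin 2) ℝ)).strictPeriods := by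
    rw [CongruenceSubgroup.strictPeriods_Gamma]
    exact AddSubgroup.mem_zmultiples _
  refine (ModularFormClass.qExpansion_coeff_unique hN0 hper
    (f := latticeEisensteinMF N (k := (k : ℤ)) (by exact_mod_cast hk) a) ?_ n).symm
  intro τ
  simpa [smul_eq_mul] using hasSum_latticeEisenstein N k a τ hk

end Expansion

end Literature.NumberTheory.ModularForms

end
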